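import Summits.BirchSwinnertonDyer.BirchSwinnertonDyer.Theorems.SylvesterTwoHeegnerIndexYinPointToricDescent
import HarnessLib

/-!
# Route `SylvesterTwoHeegnerIndex` (rung K7t): C′ and THEOREM C (item 19802) from the TORIC DESCENT DATA
# of THEOREM C′ over the ACTUAL field of definition `𝔽` — x1b [160]'s «one `2`-divisible display point
# per prime» discharged by the descent layer [161], with the Galois law for free

HONEST FRAMING (cell b2b-bsdres, seat x1b GEN 53 = O12 class lead; file `--supports
stmt-BirchSwinnertonDyer-19802`; C′ and THEOREM C stay OPEN; nothing here is a mechanism, a definition or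
a named fact). x1b [160] (`…YinPointOfOnePoint`) closes `ShaAnTwoIntegralSevenModNine` / C′ / item 19802 BY
NAME from ONE point `Y ∈ B(K)` per prime `p ≡ 7 (9)` carrying Yin's display AND `Y = 2•Y′ + T′`; the
descent layer x1b [161] (`…YinPointToricDescent`) proves `Z = 2•Z′` in `B(K)` from data over ANY finite
Galois `𝔽/K`; bsd-cm-two g9's kernel `exists_eq_two_smul_add_torsion_of_trace_of_antiTrace` (p503775) does
the same for a QUADRATIC `L/K` with `Gal(L/K) = {1, c}` (source: `L = K(i)`), where the binder
`YinToricDecomposition` must deliver `R` already over `K(i)`. This file: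

* §0 the Galois law is automatic: `N•ι Z − 2•S` torsion already forces `σS − S` torsion for every
  `σ ∈ Gal(𝔽/K)` (two's observation, any `𝔽`); hence the SLIM descent theorems
  `exists_eq_two_smul_of_smul_sub_torsion` (`W(𝔽)[2] = 0`, `N` odd, `N•ι Z − 2•S` torsion ⟹ `Z = 2•Z′`)
  and **`exists_eq_two_smul_of_trace_of_antiTrace`** ((C2) `N•ι Z + θ(R + σ̃R)` torsion + anti-trace
  `R − σ̃R` torsion ⟹ `Z = 2•Z′`, for ANY finite Galois `𝔽/K`, ANY `σ̃`, ANY additive `θ`) — i.e. two's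
  kernel theorem WITHOUT «`Gal = {1, c}`», so the binder may keep `R = Σ g̃ᵢ w` over the true field
  `𝔽 = F″ ∋` the CM points of `2`-conductor `4` (memo (B5): `[F♭ : K] = 18`) instead of descending it to
  `K(i)` inside the premise;
* §1 the hOneK datum of [160] from the DESCENT DATA (per `p`, `B`, with `K ∋ ω`, `P` handed over: `𝔽`, `Z`,
  `u`, display, `S`, `N` odd, `B(𝔽)[2] = 0`, `N•ι Z − 2•S` torsion): `exists_twoDivisible_displayPoint_of_toricDescentLaws`;
  corollaries `shaAnTwoIntegralSevenModNine_of_toricDescentLaws`, `yinPointTwoDivisibleSevenModNine_of_toricDescentLaws`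
  (C′ granted Yin's display), **`hsyPointTwoDivisibleSevenModNine_of_factsPlus_of_toricDescentLaws`** (THE LIVE
  ITEM 19802 BY NAME granted `PublishedFactsTwoPlus` + the display);
* §2 the same from the TRACE DATA of the memo over `𝔽` (`θ`, `R`, `σ̃`, `N`; (C2) + anti-trace):
  `exists_twoDivisible_displayPoint_of_toricTraceLaws`, **`hsyPointTwoDivisibleSevenModNine_of_factsPlus_of_toricTraceLaws`**.

NO definition, NO named fact, NO sorry; axioms standard; closes no item; nothing booked; no label moves.
References: MEMO-bsd-cm-two v2.10 (FROZEN 08c1ecd6da1b763f) §51.1, §52.3–§52.7; referee g43 countersign (PASS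
(S1)–(S5)); pub/bsd-cm STATUS D139 (a), D142, D146; Yin, arXiv:2607.01744 Thm 1.1, (3.5.3), Thm 2.2 (PRE);
[HuShuYin2019] Thm 1.4, p. 12.
-/

set_option autoImplicit false
-- the Summit-side namespace `Summit.BirchSwinnertonDyer.BirchSwinnertonDyer.…` (summit = problem) is mandated by D-0017
set_option linter.dupNamespace false

noncomputable section

open scoped Classical

open WeierstrassCurve WeierstrassCurve.Affine WeierstrassCurve.Affine.Point
open Summit.BirchSwinnertonDyer.BirchSwinnertonDyer.Theorems.SylvesterTwoYin
  Summit.BirchSwinnertonDyer.BirchSwinnertonDyer.Theorems.SylvesterTwoYinOnePoint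
  Literature.NumberTheory.EllipticCurves Literature.NumberTheory.EllipticCurves.HuShuYin2019

namespace Summit.BirchSwinnertonDyer.BirchSwinnertonDyer.Theorems.SylvesterTwoYinToricDescent

/-! ## §0 The Galois law is automatic: `N•ι Z − 2•S` torsion already forces `σS − S` torsion -/

section Slim

variable {K : Type*} [Field K] [CharZero K] {F : Type*} [Field F] [CharZero F] [Algebra K F]
  (W : WeierstrassCurve ℚ)

/-- **`σS − S` is torsion for free.** If `N•ι Z − 2•S` is torsion (`Z ∈ W(K)`, `S ∈ W(𝔽)`), then for every
`σ ∈ Gal(𝔽/K)`: `2•(σS − S) = (N•ι Z − 2•S) − σ(N•ι Z − 2•S)` (`σ` fixes `ι Z`) is torsion, hence so is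
`σS − S`. So the descent layer's hypothesis «`S` Galois-fixed modulo torsion» (x1b [161]
`exists_eq_two_smul_of_torsion_laws`) is implied by its other hypothesis — bsd-cm-two g9's observation in
`exists_eq_two_smul_add_torsion_of_trace_of_antiTrace` (quadratic `L/K`), here for any `𝔽/K`. [folklore] -/
theorem isOfFinAddOrder_map_sub_of_smul_sub_torsion {Z : (W.baseChange K).toAffine.Point}
    {S : (W.baseChange F).toAffine.Point} {N : ℤ}
    (hZ : IsOfFinAddOrder (N • Affine.Point.map (algebraMap K F).toRatAlgHom Z - (2 : ℤ) • S))
    (σ : F ≃ₐ[K] F) : IsOfFinAddOrder (Affine.Point.map (σ : F →ₐ[K] F) S - S) := by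
  have h2 : IsOfFinAddOrder ((2 : ℤ) • (Affine.Point.map (σ : F →ₐ[K] F) S - S)) := by
    have e : (2 : ℤ) • (Affine.Point.map (σ : F →ₐ[K] F) S - S) =
        (N • Affine.Point.map (algebraMap K F).toRatAlgHom Z - (2 : ℤ) • S) +
          -Affine.Point.map (σ : F →ₐ[K] F) (N • Affine.Point.map (algebraMap K F).toRatAlgHom Z - (2 : ℤ) • S) := by
      rw [map_sub, map_zsmul, map_zsmul, map_galois_map_algebraMap, smul_sub]; abel
    rw [e]
    exact hZ.add ((Affine.Point.map (σ : F →ₐ[K] F)).isOfFinAddOrder hZ).neg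
  obtain ⟨m, hm, hm0⟩ := h2.exists_nsmul_eq_zero
  refine isOfFinAddOrder_iff_nsmul_eq_zero.mpr ⟨m * 2, by positivity, ?_⟩
  rw [mul_nsmul', show (2 : ℕ) • (Affine.Point.map (σ : F →ₐ[K] F) S - S) =
    (2 : ℤ) • (Affine.Point.map (σ : F →ₐ[K] F) S - S) from (natCast_zsmul _ 2).symm, hm0]

/-- **DESCENT OF `2`-DIVISIBILITY, slim form.** `𝔽/K` finite Galois (char `0`), `W/ℚ`, `W(𝔽)[2] = 0`,
`Z ∈ W(K)`, `S ∈ W(𝔽)`, `N` odd with `N•ι Z − 2•S` TORSION ⟹ `Z = 2•Z′` in `W(K)` (x1b [161]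
`exists_eq_two_smul_of_torsion_laws` + §0). For bsd-cm-two's quadratic `L = K(i)` this is the kernel
theorem `exists_eq_two_smul_add_torsion_of_trace_of_antiTrace` (p503775) without the hypothesis
`Gal(L/K) = {1, c}` and with the conclusion on the nose. [cite: SilvermanAEC2009, VIII.§1] -/
theorem exists_eq_two_smul_of_smul_sub_torsion [IsGalois K F] [FiniteDimensional K F]
    (h2 : ∀ T : (W.baseChange F).toAffine.Point, (2 : ℕ) • T = 0 → T = 0)
    {Z : (W.baseChange K).toAffine.Point} {S : (W.baseChange F).toAffine.Point} {N : ℤ} (hN : Odd N)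
    (hZ : IsOfFinAddOrder (N • Affine.Point.map (algebraMap K F).toRatAlgHom Z - (2 : ℤ) • S)) :
    ∃ Z' : (W.baseChange K).toAffine.Point, Z = (2 : ℤ) • Z' :=
  exists_eq_two_smul_of_torsion_laws W h2 hN hZ (isOfFinAddOrder_map_sub_of_smul_sub_torsion W hZ)

/-- **THE TRACE FORM, slim.** `𝔽/K` finite Galois (char `0`), `W(𝔽)[2] = 0`, `θ` ANY additive map of
`W(𝔽)` (the CM unit `∓[ζ]`; no equivariance needed), `R ∈ W(𝔽)`, `σ̃ ∈ Gal(𝔽/K)` ANY element (no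
«`Gal = {1, σ̃}`» needed), `N` odd, (C2) `N•ι Z + θ(R + σ̃R)` TORSION and the anti-trace `R − σ̃R` TORSION
⟹ `Z = 2•Z′` in `W(K)`: `N•ι Z − 2•(−θR) = [N•ι Z + θ(R + σ̃R)] + θ(R − σ̃R)`. Memo two v2.10 §52.4 (C2) +
§52.7 over the actual field of definition `𝔽 = F″` of the CM points. [cite: SilvermanAEC2009, VIII.§1] -/
theorem exists_eq_two_smul_of_trace_of_antiTrace [IsGalois K F] [FiniteDimensional K F]
    (h2 : ∀ T : (W.baseChange F).toAffine.Point, (2 : ℕ) • T = 0 → T = 0)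
    (θ : (W.baseChange F).toAffine.Point →+ (W.baseChange F).toAffine.Point)
    {Z : (W.baseChange K).toAffine.Point} {R : (W.baseChange F).toAffine.Point} (σ' : F ≃ₐ[K] F)
    {N : ℤ} (hN : Odd N)
    (hC2 : IsOfFinAddOrder (N • Affine.Point.map (algebraMap K F).toRatAlgHom Z +
      θ (R + Affine.Point.map (σ' : F →ₐ[K] F) R)))
    (hanti : IsOfFinAddOrder (R - Affine.Point.map (σ' : F →ₐ[K] F) R)) :
    ∃ Z' : (W.baseChange K).toAffine.Point, Z = (2 : ℤ) • Z' := by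
  refine exists_eq_two_smul_of_smul_sub_torsion W h2 hN (S := -θ R) ?_
  have e : N • Affine.Point.map (algebraMap K F).toRatAlgHom Z - (2 : ℤ) • (-θ R) =
      (N • Affine.Point.map (algebraMap K F).toRatAlgHom Z + θ (R + Affine.Point.map (σ' : F →ₐ[K] F) R)) +
        θ (R - Affine.Point.map (σ' : F →ₐ[K] F) R) := by
    rw [map_add, map_sub, smul_neg, two_smul]; abel
  rw [e]
  exact hC2.add (θ.isOfFinAddOrder hanti)

end Slim

/-! ## §1 From the DESCENT DATA (`𝔽, Z, u, display, S, N` + three torsion laws) -/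

/-- **ONE `2`-DIVISIBLE DISPLAY POINT PER PRIME FROM THE TORIC DESCENT DATA.** If for every prime
`p ≡ 7 (9)`, every minimal `B ≅ E_p` with `#Ш_an(B) = qB`, every quadratic `K ∋ ω` with `rank_ℤ B(K) = 2` and
every rational generator `P` handed over, one is given a finite Galois extension `𝔽/K` (char `0`), a point
`Z ∈ B(K)` with a `2`-adic unit `u` and the display `(u·qB)·ĥ(ι P) = 2⁻²·ĥ(Z)`, a point `S ∈ B(𝔽)` and an
odd `N` such that `B(𝔽)[2] = 0` and `N•ι Z − 2•S` is torsion — THEN the hOneK datum of x1b [160] holds: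
that `Z` is `2•Z′ + T′` in `B(K)` (in fact `T′ = 0`; §0 `exists_eq_two_smul_of_smul_sub_torsion`). Memo
two v2.10 §52.7 for Yin's `Z_p`, over the actual field `𝔽`.
[cite-level reading: arXiv:2607.01744 Thm. 1.1, Thm. 2.2] -/
theorem exists_twoDivisible_displayPoint_of_toricDescentLaws
    (hToric : ∀ (p : ℕ), p.Prime → p % 9 = 7 →
      ∀ (B : WeierstrassCurve ℚ) [B.IsElliptic] [B.IsGloballyMinimal],
      (∃ C : VariableChange ℚ, C • B = cubeSumCurve (p : ℚ)) → ∀ (qB : ℚ), shaAn B = (qB : ℂ) →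
      ∀ (K : Type) [Field K] [NumberField K] (ω : K), ω ^ 2 + ω + 1 = 0 → Module.finrank ℚ K = 2 →
        (B.baseChange K).mordellWeilRank = 2 →
      ∀ (P : B.toAffine.Point), ¬ IsOfFinAddOrder (QuadraticDescent.incl K B P) →
        (∀ Q : B.toAffine.Point, ∃ m : ℤ,
          IsOfFinAddOrder (QuadraticDescent.incl K B Q - m • QuadraticDescent.incl K B P)) →
      ∃ (F : Type) (_ : Field F) (_ : CharZero F) (_ : Algebra K F) (_ : IsGalois K F)
        (_ : FiniteDimensional K F) (Z : (B.baseChange K).toAffine.Point) (u : ℚ)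
        (S : (B.baseChange F).toAffine.Point) (N : ℤ),
        u ≠ 0 ∧ padicValRat 2 u = 0 ∧
        ((u * qB : ℚ) : ℝ) * canonicalHeight (QuadraticDescent.incl K B P) =
          (2 : ℝ) ^ (-2 : ℤ) * canonicalHeight Z ∧
        Odd N ∧ (∀ T : (B.baseChange F).toAffine.Point, (2 : ℕ) • T = 0 → T = 0) ∧
        IsOfFinAddOrder (N • Affine.Point.map (algebraMap K F).toRatAlgHom Z - (2 : ℤ) • S))
    (p : ℕ) (hp : p.Prime) (h7 : p % 9 = 7) (B : WeierstrassCurve ℚ) [B.IsElliptic] [B.IsGloballyMinimal]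
    (hB : ∃ C : VariableChange ℚ, C • B = cubeSumCurve (p : ℚ)) (qB : ℚ) (hqB : shaAn B = (qB : ℂ))
    (K : Type) [Field K] [NumberField K] (ω : K) (hω : ω ^ 2 + ω + 1 = 0) (h2K : Module.finrank ℚ K = 2)
    (hrank : (B.baseChange K).mordellWeilRank = 2)
    (P : B.toAffine.Point) (hP : ¬ IsOfFinAddOrder (QuadraticDescent.incl K B P))
    (hgen : ∀ Q : B.toAffine.Point, ∃ m : ℤ,
      IsOfFinAddOrder (QuadraticDescent.incl K B Q - m • QuadraticDescent.incl K B P)) :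
    ∃ (Y : (B.baseChange K).toAffine.Point) (u : ℚ), u ≠ 0 ∧ padicValRat 2 u = 0 ∧
      ((u * qB : ℚ) : ℝ) * canonicalHeight (QuadraticDescent.incl K B P) =
        (2 : ℝ) ^ (-2 : ℤ) * canonicalHeight Y ∧
      ∃ Y' T' : (B.baseChange K).toAffine.Point, IsOfFinAddOrder T' ∧ Y = (2 : ℤ) • Y' + T' := by
  obtain ⟨F, _, _, _, _, _, Z, u, S, N, hu0, hu, hdisp, hN, h2, hZ⟩ :=
    hToric p hp h7 B hB qB hqB K ω hω h2K hrank P hP hgen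
  obtain ⟨Z', hZ'⟩ := exists_eq_two_smul_of_smul_sub_torsion B h2 hN hZ
  exact ⟨Z, u, hu0, hu, hdisp, Z', 0, IsOfFinAddOrder.zero, by rw [hZ', add_zero]⟩

/-- **`0 ≤ ord₂ #Ш_an(E_p)` FROM THE TORIC DESCENT DATA** (granted Yin's display, which hands over `K`,
rank and generator): §1 + x1b [160] `shaAnTwoIntegralSevenModNine_of_forall_field`.
[cite-level reading: arXiv:2607.01744 Thm. 1.1, p. 12] -/
theorem shaAnTwoIntegralSevenModNine_of_toricDescentLaws (hY : YinHeightDisplay)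
    (hToric : ∀ (p : ℕ), p.Prime → p % 9 = 7 →
      ∀ (B : WeierstrassCurve ℚ) [B.IsElliptic] [B.IsGloballyMinimal],
      (∃ C : VariableChange ℚ, C • B = cubeSumCurve (p : ℚ)) → ∀ (qB : ℚ), shaAn B = (qB : ℂ) →
      ∀ (K : Type) [Field K] [NumberField K] (ω : K), ω ^ 2 + ω + 1 = 0 → Module.finrank ℚ K = 2 →
        (B.baseChange K).mordellWeilRank = 2 →
      ∀ (P : B.toAffine.Point), ¬ IsOfFinAddOrder (QuadraticDescent.incl K B P) →
        (∀ Q : B.toAffine.Point, ∃ m : ℤ,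
          IsOfFinAddOrder (QuadraticDescent.incl K B Q - m • QuadraticDescent.incl K B P)) →
      ∃ (F : Type) (_ : Field F) (_ : CharZero F) (_ : Algebra K F) (_ : IsGalois K F)
        (_ : FiniteDimensional K F) (Z : (B.baseChange K).toAffine.Point) (u : ℚ)
        (S : (B.baseChange F).toAffine.Point) (N : ℤ),
        u ≠ 0 ∧ padicValRat 2 u = 0 ∧
        ((u * qB : ℚ) : ℝ) * canonicalHeight (QuadraticDescent.incl K B P) =
          (2 : ℝ) ^ (-2 : ℤ) * canonicalHeight Z ∧
        Odd N ∧ (∀ T : (B.baseChange F).toAffine.Point, (2 : ℕ) • T = 0 → T = 0) ∧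
        IsOfFinAddOrder (N • Affine.Point.map (algebraMap K F).toRatAlgHom Z - (2 : ℤ) • S)) :
    ShaAnTwoIntegralSevenModNine :=
  shaAnTwoIntegralSevenModNine_of_forall_field hY
    fun p hp h7 B _ _ hB qB hqB K _ _ ω hω h2K hrank P hP hgen =>
      exists_twoDivisible_displayPoint_of_toricDescentLaws hToric p hp h7 B hB qB hqB K ω hω h2K hrank P hP hgen

/-- **CONJECTURE C′ FROM THE TORIC DESCENT DATA** (granted Yin's display): §1 + x1b [160]
`yinPointTwoDivisibleSevenModNine_of_forall_field`. C′ stays OPEN (the data are not in the tree).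
[cite-level reading: arXiv:2607.01744 Thm. 1.1, p. 12] -/
theorem yinPointTwoDivisibleSevenModNine_of_toricDescentLaws (hY : YinHeightDisplay)
    (hToric : ∀ (p : ℕ), p.Prime → p % 9 = 7 →
      ∀ (B : WeierstrassCurve ℚ) [B.IsElliptic] [B.IsGloballyMinimal],
      (∃ C : VariableChange ℚ, C • B = cubeSumCurve (p : ℚ)) → ∀ (qB : ℚ), shaAn B = (qB : ℂ) →
      ∀ (K : Type) [Field K] [NumberField K] (ω : K), ω ^ 2 + ω + 1 = 0 → Module.finrank ℚ K = 2 →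
        (B.baseChange K).mordellWeilRank = 2 →
      ∀ (P : B.toAffine.Point), ¬ IsOfFinAddOrder (QuadraticDescent.incl K B P) →
        (∀ Q : B.toAffine.Point, ∃ m : ℤ,
          IsOfFinAddOrder (QuadraticDescent.incl K B Q - m • QuadraticDescent.incl K B P)) →
      ∃ (F : Type) (_ : Field F) (_ : CharZero F) (_ : Algebra K F) (_ : IsGalois K F)
        (_ : FiniteDimensional K F) (Z : (B.baseChange K).toAffine.Point) (u : ℚ)
        (S : (B.baseChange F).toAffine.Point) (N : ℤ),
        u ≠ 0 ∧ padicValRat 2 u = 0 ∧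
        ((u * qB : ℚ) : ℝ) * canonicalHeight (QuadraticDescent.incl K B P) =
          (2 : ℝ) ^ (-2 : ℤ) * canonicalHeight Z ∧
        Odd N ∧ (∀ T : (B.baseChange F).toAffine.Point, (2 : ℕ) • T = 0 → T = 0) ∧
        IsOfFinAddOrder (N • Affine.Point.map (algebraMap K F).toRatAlgHom Z - (2 : ℤ) • S)) :
    YinPointTwoDivisibleSevenModNine :=
  yinPointTwoDivisibleSevenModNine_of_forall_field hY
    fun p hp h7 B _ _ hB qB hqB K _ _ ω hω h2K hrank P hP hgen =>
      exists_twoDivisible_displayPoint_of_toricDescentLaws hToric p hp h7 B hB qB hqB K ω hω h2K hrank P hP hgen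

/-- **THE LIVE ITEM 19802 (THEOREM C) BY NAME FROM THE TORIC DESCENT DATA**, granted the route's
support conjunction `PublishedFactsTwoPlus` and Yin's display: §1 + x1b [160]
`hsyPointTwoDivisibleSevenModNine_of_factsPlus_of_forall_field`. Nothing is closed.
[cite-level reading: arXiv:2607.01744 Thm. 1.1, p. 12; HuShuYin2019 Thm. 1.4, p. 12] -/
theorem hsyPointTwoDivisibleSevenModNine_of_factsPlus_of_toricDescentLaws
    (hFP : Theses.SylvesterTwoHeegnerIndex.PublishedFactsTwoPlus) (hY : YinHeightDisplay)
    (hToric : ∀ (p : ℕ), p.Prime → p % 9 = 7 →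
      ∀ (B : WeierstrassCurve ℚ) [B.IsElliptic] [B.IsGloballyMinimal],
      (∃ C : VariableChange ℚ, C • B = cubeSumCurve (p : ℚ)) → ∀ (qB : ℚ), shaAn B = (qB : ℂ) →
      ∀ (K : Type) [Field K] [NumberField K] (ω : K), ω ^ 2 + ω + 1 = 0 → Module.finrank ℚ K = 2 →
        (B.baseChange K).mordellWeilRank = 2 →
      ∀ (P : B.toAffine.Point), ¬ IsOfFinAddOrder (QuadraticDescent.incl K B P) →
        (∀ Q : B.toAffine.Point, ∃ m : ℤ,
          IsOfFinAddOrder (QuadraticDescent.incl K B Q - m • QuadraticDescent.incl K B P)) →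
      ∃ (F : Type) (_ : Field F) (_ : CharZero F) (_ : Algebra K F) (_ : IsGalois K F)
        (_ : FiniteDimensional K F) (Z : (B.baseChange K).toAffine.Point) (u : ℚ)
        (S : (B.baseChange F).toAffine.Point) (N : ℤ),
        u ≠ 0 ∧ padicValRat 2 u = 0 ∧
        ((u * qB : ℚ) : ℝ) * canonicalHeight (QuadraticDescent.incl K B P) =
          (2 : ℝ) ^ (-2 : ℤ) * canonicalHeight Z ∧
        Odd N ∧ (∀ T : (B.baseChange F).toAffine.Point, (2 : ℕ) • T = 0 → T = 0) ∧
        IsOfFinAddOrder (N • Affine.Point.map (algebraMap K F).toRatAlgHom Z - (2 : ℤ) • S)) :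
    Theses.SylvesterTwoHeegnerIndex.HSYPointTwoDivisibleSevenModNine :=
  hsyPointTwoDivisibleSevenModNine_of_factsPlus_of_forall_field hFP hY
    fun p hp h7 B _ _ hB qB hqB K _ _ ω hω h2K hrank P hP hgen =>
      exists_twoDivisible_displayPoint_of_toricDescentLaws hToric p hp h7 B hB qB hqB K ω hω h2K hrank P hP hgen

/-! ## §2 From the TRACE LAWS of the memo (`θ, R, σ̃, N`; (C2), anti-trace, `R` fixed mod torsion) -/

/-- **ONE `2`-DIVISIBLE DISPLAY POINT PER PRIME FROM THE TORIC TRACE LAWS** — the memo's own currency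
(§52.4 (C2), §52.5–§52.7): per `p`, `B`, and `K ∋ ω`, `P` handed over, a finite Galois `𝔽/K` with
`B(𝔽)[2] = 0` ((B4)), `Z ∈ B(K)` with unit `u` and display, ANY additive `θ` on `B(𝔽)` (`∓[ζ]`),
`R ∈ B(𝔽)`, ANY `σ̃ ∈ Gal(𝔽/K)`, `N` odd, with (C2) `N•ι Z + θ(R + σ̃R)` TORSION and the anti-trace
`R − σ̃R` TORSION ((S3)/(S4)). Then the hOneK datum of x1b [160] holds (§0
`exists_eq_two_smul_of_trace_of_antiTrace`). [cite-level reading: arXiv:2607.01744 Thm. 2.2] -/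
theorem exists_twoDivisible_displayPoint_of_toricTraceLaws
    (hTrace : ∀ (p : ℕ), p.Prime → p % 9 = 7 →
      ∀ (B : WeierstrassCurve ℚ) [B.IsElliptic] [B.IsGloballyMinimal],
      (∃ C : VariableChange ℚ, C • B = cubeSumCurve (p : ℚ)) → ∀ (qB : ℚ), shaAn B = (qB : ℂ) →
      ∀ (K : Type) [Field K] [NumberField K] (ω : K), ω ^ 2 + ω + 1 = 0 → Module.finrank ℚ K = 2 →
        (B.baseChange K).mordellWeilRank = 2 →
      ∀ (P : B.toAffine.Point), ¬ IsOfFinAddOrder (QuadraticDescent.incl K B P) →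
        (∀ Q : B.toAffine.Point, ∃ m : ℤ,
          IsOfFinAddOrder (QuadraticDescent.incl K B Q - m • QuadraticDescent.incl K B P)) →
      ∃ (F : Type) (_ : Field F) (_ : CharZero F) (_ : Algebra K F) (_ : IsGalois K F)
        (_ : FiniteDimensional K F) (Z : (B.baseChange K).toAffine.Point) (u : ℚ)
        (θ : (B.baseChange F).toAffine.Point →+ (B.baseChange F).toAffine.Point)
        (R : (B.baseChange F).toAffine.Point) (σ' : F ≃ₐ[K] F) (N : ℤ),
        u ≠ 0 ∧ padicValRat 2 u = 0 ∧
        ((u * qB : ℚ) : ℝ) * canonicalHeight (QuadraticDescent.incl K B P) =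
          (2 : ℝ) ^ (-2 : ℤ) * canonicalHeight Z ∧
        Odd N ∧ (∀ T : (B.baseChange F).toAffine.Point, (2 : ℕ) • T = 0 → T = 0) ∧
        IsOfFinAddOrder (N • Affine.Point.map (algebraMap K F).toRatAlgHom Z +
          θ (R + Affine.Point.map (σ' : F →ₐ[K] F) R)) ∧
        IsOfFinAddOrder (R - Affine.Point.map (σ' : F →ₐ[K] F) R))
    (p : ℕ) (hp : p.Prime) (h7 : p % 9 = 7) (B : WeierstrassCurve ℚ) [B.IsElliptic] [B.IsGloballyMinimal]
    (hB : ∃ C : VariableChange ℚ, C • B = cubeSumCurve (p : ℚ)) (qB : ℚ) (hqB : shaAn B = (qB : ℂ))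
    (K : Type) [Field K] [NumberField K] (ω : K) (hω : ω ^ 2 + ω + 1 = 0) (h2K : Module.finrank ℚ K = 2)
    (hrank : (B.baseChange K).mordellWeilRank = 2)
    (P : B.toAffine.Point) (hP : ¬ IsOfFinAddOrder (QuadraticDescent.incl K B P))
    (hgen : ∀ Q : B.toAffine.Point, ∃ m : ℤ,
      IsOfFinAddOrder (QuadraticDescent.incl K B Q - m • QuadraticDescent.incl K B P)) :
    ∃ (Y : (B.baseChange K).toAffine.Point) (u : ℚ), u ≠ 0 ∧ padicValRat 2 u = 0 ∧
      ((u * qB : ℚ) : ℝ) * canonicalHeight (QuadraticDescent.incl K B P) =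
        (2 : ℝ) ^ (-2 : ℤ) * canonicalHeight Y ∧
      ∃ Y' T' : (B.baseChange K).toAffine.Point, IsOfFinAddOrder T' ∧ Y = (2 : ℤ) • Y' + T' := by
  obtain ⟨F, _, _, _, _, _, Z, u, θ, R, σ', N, hu0, hu, hdisp, hN, h2, hC2, hanti⟩ :=
    hTrace p hp h7 B hB qB hqB K ω hω h2K hrank P hP hgen
  obtain ⟨Z', hZ'⟩ := exists_eq_two_smul_of_trace_of_antiTrace B h2 θ σ' hN hC2 hanti
  exact ⟨Z, u, hu0, hu, hdisp, Z', 0, IsOfFinAddOrder.zero, by rw [hZ', add_zero]⟩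

/-- **THE LIVE ITEM 19802 (THEOREM C) BY NAME FROM THE TORIC TRACE LAWS**, granted `PublishedFactsTwoPlus`
and Yin's display: §2 + x1b [160] `hsyPointTwoDivisibleSevenModNine_of_factsPlus_of_forall_field`. Nothing
is closed. [cite-level reading: arXiv:2607.01744 Thm. 1.1, p. 12; HuShuYin2019 Thm. 1.4, p. 12] -/
theorem hsyPointTwoDivisibleSevenModNine_of_factsPlus_of_toricTraceLaws
    (hFP : Theses.SylvesterTwoHeegnerIndex.PublishedFactsTwoPlus) (hY : YinHeightDisplay)
    (hTrace : ∀ (p : ℕ), p.Prime → p % 9 = 7 →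
      ∀ (B : WeierstrassCurve ℚ) [B.IsElliptic] [B.IsGloballyMinimal],
      (∃ C : VariableChange ℚ, C • B = cubeSumCurve (p : ℚ)) → ∀ (qB : ℚ), shaAn B = (qB : ℂ) →
      ∀ (K : Type) [Field K] [NumberField K] (ω : K), ω ^ 2 + ω + 1 = 0 → Module.finrank ℚ K = 2 →
        (B.baseChange K).mordellWeilRank = 2 →
      ∀ (P : B.toAffine.Point), ¬ IsOfFinAddOrder (QuadraticDescent.incl K B P) →
        (∀ Q : B.toAffine.Point, ∃ m : ℤ,
          IsOfFinAddOrder (QuadraticDescent.incl K B Q - m • QuadraticDescent.incl K B P)) →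
      ∃ (F : Type) (_ : Field F) (_ : CharZero F) (_ : Algebra K F) (_ : IsGalois K F)
        (_ : FiniteDimensional K F) (Z : (B.baseChange K).toAffine.Point) (u : ℚ)
        (θ : (B.baseChange F).toAffine.Point →+ (B.baseChange F).toAffine.Point)
        (R : (B.baseChange F).toAffine.Point) (σ' : F ≃ₐ[K] F) (N : ℤ),
        u ≠ 0 ∧ padicValRat 2 u = 0 ∧
        ((u * qB : ℚ) : ℝ) * canonicalHeight (QuadraticDescent.incl K B P) =
          (2 : ℝ) ^ (-2 : ℤ) * canonicalHeight Z ∧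
        Odd N ∧ (∀ T : (B.baseChange F).toAffine.Point, (2 : ℕ) • T = 0 → T = 0) ∧
        IsOfFinAddOrder (N • Affine.Point.map (algebraMap K F).toRatAlgHom Z +
          θ (R + Affine.Point.map (σ' : F →ₐ[K] F) R)) ∧
        IsOfFinAddOrder (R - Affine.Point.map (σ' : F →ₐ[K] F) R)) :
    Theses.SylvesterTwoHeegnerIndex.HSYPointTwoDivisibleSevenModNine :=
  hsyPointTwoDivisibleSevenModNine_of_factsPlus_of_forall_field hFP hY
    fun p hp h7 B _ _ hB qB hqB K _ _ ω hω h2K hrank P hP hgen =>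
      exists_twoDivisible_displayPoint_of_toricTraceLaws hTrace p hp h7 B hB qB hqB K ω hω h2K hrank P hP hgen

end Summit.BirchSwinnertonDyer.BirchSwinnertonDyer.Theorems.SylvesterTwoYinToricDescent

end
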